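import Summits.BirchSwinnertonDyer.BirchSwinnertonDyer.Theorems.SignedLowerHalvesSmallImageLowerHalfBothSignsRttCharRoadE2OfDepletedJunction
import Summits.BirchSwinnertonDyer.BirchSwinnertonDyer.Theorems.SignedLowerHalvesSmallImageLowerHalfBothSignsRttCharRoadE2OfTwist
import HarnessLib

/-!
# Route `SignedLowerHalves`, crux L `SmallImageLowerHalfBothSigns` (stmt-BirchSwinnertonDyer-23599), line `rtt_w3` v14 → v15 — E2 (RULING «U» + (F1)): THE v15 CONSUMER,
# DEPLETED FORM — frame assembled on the TWISTED skeleton (`h52` from the source `D₀` + Tw data), `hdef` from `H1[f] = 0`, unit index `a`, and the DEPLETED junction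
# (`ιB : B' ↪ B`, `E`, `s'` with `ιB ∘ s' = E • s`, `j₀ : B' → Q` exact, `hY'`), element `z := j₀ (s' ζ̄_a)`

WHY. Combination of p782680 `charRoad_E2_of_roadD_junction_of_twist` (frame assembly: `ζ̄ := zetaSp f D a`, `hζ`/`D.Z = D.cyclic a` from `IsUnit (φ (D.nsub a))`, `hdef` from
`hH1` through `eH := j₀ ∘ s'`, `h52`/finiteness from `D₀` + `σ`, `e₀ e₁ e₂`) with the depleted junction consumer `charRoad_E2_of_roadD_junction_depleted` (LEAD, sequel file).
★★★★★★ `charRoad_E2_of_roadD_junction_depleted_of_twist` — remaining HYPOTHESES = rows of BRIEF-E2 rev 5.1/5.2: D-tw-coh (`σ e₀ e₁ e₂`), J2 (`s htB hcoker`), J3 (`B' ιB E s' hs' j₀ hexact`),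
J4 (`hY'`), (4′) `hH1`, 𝔞 (`a ha`), (5′)/(7′) (`Col hCol`), plus the source datum `D₀ h52₀` (FACT) and the stub's glue data.

THEOREMS ONLY (`--supports stmt-BirchSwinnertonDyer-23599` helper); closes nothing; crux L, crux M, E2 and BSD remain OPEN and are proved for NO curve by any of this.
[cite: Kobayashi2003, Thm. 7.3 i)] [cite: GreenbergVatsal2000, §2 Prop. (2.4)] [cite: JohnsonLeungKings2011, Thm. 5.2, Cor. 5.3, §5.2] [cite: Rubin2000, Ch. VI §1–§2] [cite: Washington1997, §13.2]
-/

set_option autoImplicit false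
-- the Theorems namespace of this sub repeats the summit name by design (D-0017 nested layout)
set_option linter.dupNamespace false

noncomputable section
open scoped Pointwise Classical MatrixGroups ModularForm

open PowerSeries Literature.NumberTheory.Automorphic Literature.NumberTheory.EllipticCurves Literature.NumberTheory.EllipticCurves.Module
open Literature.NumberTheory.ComplexMultiplication.EllipticUnits.JohnsonLeungKings2011
open Summit.BirchSwinnertonDyer.BirchSwinnertonDyer.Theorems.SmallImageRttD2LamSpec
open Summit.BirchSwinnertonDyer.BirchSwinnertonDyer.Theorems.SmallImageRttD2Spec
open Literature.NumberTheory.IwasawaTheory Literature.NumberTheory.EllipticCurves.GreenbergVatsal2000 CongruenceSubgroup NumberField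
  IsDedekindDomain Rat.HeightOneSpectrum Literature.NumberTheory.EllipticCurves.ModularForms

namespace Summit.BirchSwinnertonDyer.BirchSwinnertonDyer.Theorems.SmallImageRttCharRoad

universe u v v₀ w w' w''

section E2

variable {p : ℕ} [Fact p.Prime] {S : Set (PadicAlgCl p)} [Algebra (IwasawaAlgebra p) (IwasawaAlgebraO S)]

set_option maxHeartbeats 400000 in -- same budget line as p780454/p782277
/-- ★★★★★★ **The v15 consumer, DEPLETED form, on the twisted skeleton.** See the module docstring for the binder groups.
[cite: Kobayashi2003, Thm. 7.3 i)] [cite: GreenbergVatsal2000, §2 Prop. (2.4)] [cite: JohnsonLeungKings2011, Thm. 5.2, Cor. 5.3] [cite: Rubin2000, Ch. VI §1–§2] -/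
theorem charRoad_E2_of_roadD_junction_depleted_of_twist [IsLocalRing (padicCoeffIntegers S)] (hS : 0 < Module.finrank ℚ_[p] (padicCoeffField S))
    (halg : ∀ r : IwasawaAlgebra p, algebraMap (IwasawaAlgebra p) (IwasawaAlgebraO S) r = iwasawaToIwasawaO S r)
    {M : ℕ} [NeZero M] (g : CuspForm (Gamma0 M) 2) (ι : coeffField g →+* PadicAlgCl p) (hng : IsNewform0 g)
    (S₀ : Finset (HeightOneSpectrum (𝓞 ℚ)))
    {Q X' : Type} [AddCommGroup Q] [AddCommGroup X'] [Module (IwasawaAlgebraO S) Q] [Module (IwasawaAlgebra p) Q]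
    [IsScalarTower (IwasawaAlgebra p) (IwasawaAlgebraO S) Q] [Module (IwasawaAlgebraO S) X'] [Module (IwasawaAlgebra p) X']
    [IsScalarTower (IwasawaAlgebra p) (IwasawaAlgebraO S) X'] [Module.Finite (IwasawaAlgebra p) X'] (hX' : Module.IsTorsion (IwasawaAlgebra p) X')
    (gX : Q →ₗ[IwasawaAlgebraO S] X') (b : padicCoeffIntegers S)
    (hb : b ∈ IsLocalRing.maximalIdeal (padicCoeffIntegers S)) (φ : PowerSeries (IwasawaAlgebraO S) →+* IwasawaAlgebraO S)
    (hφf : φ (C (X - C b)) = 0) (hC : ∀ a : padicCoeffIntegers S, φ (C (C a)) = C a) (hX : φ X = X)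
    (hker : RingHom.ker φ = Ideal.span {C (X - C b)})
    {Aidx H0 H1 H2 : Type v} [AddCommGroup H0]
    [Module (PowerSeries (IwasawaAlgebraO S)) H0] [AddCommGroup H1] [Module (PowerSeries (IwasawaAlgebraO S)) H1] [AddCommGroup H2]
    [Module (PowerSeries (IwasawaAlgebraO S)) H2]
    -- the source skeleton `D₀` (honda's datum for the finite-order `χ₀`, FACT `cor53_thm52ShapeO`) and the twist `σ = Tw_η`
    {H0₀ H1₀ H2₀ : Type v₀} [AddCommGroup H0₀] [Module (PowerSeries (IwasawaAlgebraO S)) H0₀] [AddCommGroup H1₀]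
    [Module (PowerSeries (IwasawaAlgebraO S)) H1₀] [AddCommGroup H2₀] [Module (PowerSeries (IwasawaAlgebraO S)) H2₀]
    [Module.Finite (PowerSeries (IwasawaAlgebraO S)) H1₀] [Module.Finite (PowerSeries (IwasawaAlgebraO S)) H2₀]
    (D₀ : ZetaSkeleton (PowerSeries (IwasawaAlgebraO S)) Aidx H0₀ H1₀ H2₀) (h52₀ : D₀.Thm52Shape)
    (σ : PowerSeries (IwasawaAlgebraO S) ≃+* PowerSeries (IwasawaAlgebraO S))
    (D : ZetaSkeleton (PowerSeries (IwasawaAlgebraO S)) Aidx H0 H1 H2)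
    (e₀ : H0₀ ≃+ H0) (e₁ : H1₀ ≃+ H1) (he₁ : ∀ (r : PowerSeries (IwasawaAlgebraO S)) (m : H1₀), e₁ (r • m) = σ r • e₁ m)
    (haZ : ∀ a : Aidx, e₁ (D₀.aZeta a) = D.aZeta a)
    (e₂ : H2₀ ≃+ H2) (he₂ : ∀ (r : PowerSeries (IwasawaAlgebraO S)) (m : H2₀), e₂ (r • m) = σ r • e₂ m)
    (hH1 : Submodule.torsionBy (PowerSeries (IwasawaAlgebraO S)) H1 (C (X - C b)) = ⊥) (a : Aidx) (ha : IsUnit (φ (D.nsub a)))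
    [Module (IwasawaAlgebraO S) (QuotSMulTop (C (X - C b) : PowerSeries (IwasawaAlgebraO S)) H1)]
    (hιH : ∀ (l : IwasawaAlgebraO S) (x : QuotSMulTop (C (X - C b) : PowerSeries (IwasawaAlgebraO S)) H1),
      l • x = (PowerSeries.map (PowerSeries.C : padicCoeffIntegers S →+* IwasawaAlgebraO S) l) • x)
    [Module (IwasawaAlgebra p) (QuotSMulTop (C (X - C b) : PowerSeries (IwasawaAlgebraO S)) H1)]
    [IsScalarTower (IwasawaAlgebra p) (IwasawaAlgebraO S) (QuotSMulTop (C (X - C b) : PowerSeries (IwasawaAlgebraO S)) H1)]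
    [Module (IwasawaAlgebra p) (Submodule.torsionBy (PowerSeries (IwasawaAlgebraO S)) H2 (C (X - C b)))]
    (hΛT : ∀ (r : IwasawaAlgebra p) (x : Submodule.torsionBy (PowerSeries (IwasawaAlgebraO S)) H2 (C (X - C b))),
      r • x = (PowerSeries.map (PowerSeries.C : padicCoeffIntegers S →+* IwasawaAlgebraO S) (iwasawaToIwasawaO S r)) • x)
    [Module (IwasawaAlgebra p) (QuotSMulTop (C (X - C b) : PowerSeries (IwasawaAlgebraO S)) H2)]
    (hΛ2 : ∀ (r : IwasawaAlgebra p) (x : QuotSMulTop (C (X - C b) : PowerSeries (IwasawaAlgebraO S)) H2),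
      r • x = (PowerSeries.map (PowerSeries.C : padicCoeffIntegers S →+* IwasawaAlgebraO S) (iwasawaToIwasawaO S r)) • x)
    -- the DEPLETED junction (RULING (F1))
    {B : Type w} [AddCommGroup B] [Module (IwasawaAlgebraO S) B] [Module (IwasawaAlgebra p) B] [IsScalarTower (IwasawaAlgebra p) (IwasawaAlgebraO S) B]
    [Module.Finite (IwasawaAlgebra p) B]
    {B' : Type w''} [AddCommGroup B'] [Module (IwasawaAlgebraO S) B'] [Module (IwasawaAlgebra p) B'] [IsScalarTower (IwasawaAlgebra p) (IwasawaAlgebraO S) B']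
    (s : QuotSMulTop (C (X - C b) : PowerSeries (IwasawaAlgebraO S)) H1 →ₗ[IwasawaAlgebraO S] B)
    (htB : Module.IsTorsion (IwasawaAlgebra p) (B ⧸ LinearMap.range s))
    (hcoker : lambdaInvariant p (B ⧸ LinearMap.range s) ≤ lambdaInvariant p (Submodule.torsionBy (PowerSeries (IwasawaAlgebraO S)) H2 (C (X - C b))))
    (ιB : B' →ₗ[IwasawaAlgebraO S] B) (hιB : Function.Injective ιB) (E : IwasawaAlgebraO S) (hE : E ≠ 0)
    (s' : QuotSMulTop (C (X - C b) : PowerSeries (IwasawaAlgebraO S)) H1 →ₗ[IwasawaAlgebraO S] B') (hs' : ∀ x, ιB (s' x) = E • s x)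
    (j₀ : B' →ₗ[IwasawaAlgebraO S] Q) (hexact : Function.Exact j₀ gX)
    (hY : lambdaInvariant p (QuotSMulTop (C (X - C b) : PowerSeries (IwasawaAlgebraO S)) H2) + lambdaInvariant p (IwasawaAlgebraO S ⧸ Ideal.span {E}) ≤
      lambdaInvariant p (X' ⧸ LinearMap.range gX) + lambdaInvariant p (B ⧸ LinearMap.range ιB))
    (Col : Q ≃ₗ[IwasawaAlgebraO S] IwasawaAlgebraO S) (L : IwasawaAlgebraO (Set.range ι)) (hL : L ≠ 0) {c : PadicAlgCl p} (hc : c ≠ 0)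
    (fv : HeightOneSpectrum (𝓞 ℚ) → ℤ_[p]) (hfv : ∀ v ∈ S₀, fv v ≠ 0 ∧ (fv v).valuation = (frobeniusExponent p (natGenerator v : ℤ_[p])).valuation)
    (hCol : iwasawaOToPowerSeries S (Col (j₀ (s' (zetaSp (C (X - C b) : PowerSeries (IwasawaAlgebraO S)) D a)))) =
      PowerSeries.C c * iwasawaOToPowerSeries (Set.range ι) L *
        ∏ v ∈ S₀, Polynomial.aeval (PowerSeries.C ((natGenerator v : PadicAlgCl p)⁻¹) *
            (PowerSeries.binomialSeries ℤ_[p] (fv v)).map (algebraMap ℤ_[p] (PadicAlgCl p)))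
          (1 - Polynomial.C (embCoeff g ι (natGenerator v)) * Polynomial.X +
            (if natGenerator v ∣ M then 0 else Polynomial.C (natGenerator v : PadicAlgCl p)) * Polynomial.X ^ 2)) :
    ∃ d : ℕ, (∀ k : ℕ, ‖PowerSeries.coeff k (iwasawaOToPowerSeries (Set.range ι) L)‖ ≤
        ‖PowerSeries.coeff d (iwasawaOToPowerSeries (Set.range ι) L)‖) ∧
      (∀ k : ℕ, k < d → ‖PowerSeries.coeff k (iwasawaOToPowerSeries (Set.range ι) L)‖ <
        ‖PowerSeries.coeff d (iwasawaOToPowerSeries (Set.range ι) L)‖) ∧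
      Module.finrank ℚ_[p] (padicCoeffField S) * (d + ∑ v ∈ S₀, p ^ (frobeniusExponent p (natGenerator v : ℤ_[p])).valuation *
        layerLambda ((1 - Polynomial.C (embCoeff g ι (natGenerator v)) * Polynomial.X +
          (if natGenerator v ∣ M then 0 else Polynomial.C (natGenerator v : PadicAlgCl p)) * Polynomial.X ^ 2).comp
            (Polynomial.C ((natGenerator v : PadicAlgCl p)⁻¹) * (Polynomial.X + 1)))) ≤ lambdaInvariant p X' := by
  haveI : FiniteDimensional ℚ_[p] (padicCoeffField S) := Module.finite_of_finrank_pos hS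
  haveI : IsDiscreteValuationRing (padicCoeffIntegers S) := by
    rw [padicCoeffIntegers_eq_unitBall S]; exact LambdaLowerBoundO.isDiscreteValuationRing_unitBall p _
  haveI : Module.Finite (PowerSeries (IwasawaAlgebraO S)) H1 := moduleFinite_of_semilinearEquiv σ e₁ he₁
  haveI : Module.Finite (PowerSeries (IwasawaAlgebraO S)) H2 := moduleFinite_of_semilinearEquiv σ e₂ he₂
  have h52 : D.Thm52Shape := thm52Shape_of_semilinearEquiv σ D₀ D e₁ he₁ haZ e₀ e₂ he₂ h52₀
  -- the specialised zeta class, its depleted image in `Q`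
  set ζ : QuotSMulTop (C (X - C b) : PowerSeries (IwasawaAlgebraO S)) H1 := zetaSp (C (X - C b) : PowerSeries (IwasawaAlgebraO S)) D a with hζdef
  set z : Q := j₀ (s' ζ) with hzdef
  have hζ : (D.Z).map ((C (X - C b) : PowerSeries (IwasawaAlgebraO S)) • (⊤ : Submodule (PowerSeries (IwasawaAlgebraO S)) H1)).mkQ =
      Submodule.span (PowerSeries (IwasawaAlgebraO S)) {ζ} :=
    map_mkQ_Z_eq_span_zetaSp_of_isUnit b φ hC hX hker D a ha
  have hZ : D.Z = D.cyclic a := Z_eq_cyclic_of_isUnit D a (isUnit_of_isUnit_map hb φ hφf hC hX ha)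
  -- `Q ≅ Λ_𝒪` is torsion-free
  haveI : NoZeroSMulDivisors (IwasawaAlgebraO S) Q := by
    refine ⟨fun {c x} h ↦ ?_⟩
    have h' : c * Col x = 0 := by rw [← smul_eq_mul, ← map_smul, h, map_zero]
    exact (mul_eq_zero.mp h').imp_right fun hx ↦ Col.injective (by rw [hx, map_zero])
  -- `z ≠ 0` from (an)
  haveI : FiniteDimensional ℚ (coeffField g) := IsNewform0.finiteDimensional_coeffField_holds hng
  haveI : FiniteDimensional ℚ_[p] (padicCoeffField (Set.range ι)) := GreenbergSelmer.finiteDimensional_padicCoeffField ι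
  have hz0 : z ≠ 0 := by
    obtain ⟨d, hle, hlt⟩ := SmallImageRttE2Num.exists_normLambda_iwasawaAlgebraO p (Set.range ι) L hL
    have hL' : iwasawaOToPowerSeries (Set.range ι) L ≠ 0 :=
      (map_ne_zero_iff _ (iwasawaOToPowerSeries_injective _)).mpr hL
    have hP : ∀ v ∈ S₀, (1 - Polynomial.C (embCoeff g ι (natGenerator v)) * Polynomial.X +
        (if natGenerator v ∣ M then 0 else Polynomial.C (natGenerator v : PadicAlgCl p)) * Polynomial.X ^ 2) ≠ 0 :=
      fun v _ h0 ↦ by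
        have h1 := congrArg (fun P : Polynomial (PadicAlgCl p) ↦ P.coeff 0) h0
        simp only [Polynomial.coeff_add, Polynomial.coeff_sub, Polynomial.coeff_one_zero, Polynomial.coeff_C_mul,
          Polynomial.coeff_X_zero, mul_zero, sub_zero, Polynomial.coeff_zero] at h1
        split_ifs at h1 with hd
        · simp only [zero_mul, Polynomial.coeff_zero, add_zero, one_ne_zero] at h1
        · simp only [Polynomial.coeff_C_mul, Polynomial.coeff_X_pow, mul_ite, mul_one, mul_zero] at h1
          norm_num at h1
    have hu : ∀ v ∈ S₀, ((natGenerator v : PadicAlgCl p))⁻¹ ≠ 0 := fun v _ ↦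
      inv_ne_zero (Nat.cast_ne_zero.mpr (prime_natGenerator v).ne_zero)
    have hColz : Col z ≠ 0 := ne_zero_of_eulerProduct S S₀ hc hL' hle hlt _ _ fv hP hu (fun v hv ↦ (hfv v hv).1) hCol
    intro h0
    exact hColz (by rw [h0, map_zero])
  -- `hdef` from `H1[f] = 0` through `eH := j₀ ∘ s'`
  have hdef : Submodule.torsionBy (PowerSeries (IwasawaAlgebraO S)) (H1 ⧸ D.Z) (C (X - C b)) = ⊥ :=
    torsionBy_quotient_Z_eq_bot_of_quotSMulTop_linearMap b φ hC hX hker D a hZ hH1 hιH (j₀ ∘ₗ s') (by simpa only [LinearMap.comp_apply] using hz0)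
  exact charRoad_E2_of_roadD_junction_depleted hS halg g ι hng S₀ hX' gX b φ hφf hC hX hker D h52 hdef hιH hΛT hΛ2 ζ hζ
    s htB hcoker ιB hιB E hE s' hs' j₀ hexact hY Col L hL hc fv hfv hCol

end E2

end Summit.BirchSwinnertonDyer.BirchSwinnertonDyer.Theorems.SmallImageRttCharRoad

end
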